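import Summits.AtomisticToContinuum.HydrodynamicLimit.Theses.RelayRaceLocality
import Literature.Barriers.AtomisticToContinuum.BoltzmannHypothesis
import Literature.MathematicalPhysics.KineticTheory.HardSphereEulerProofs
import Literature.MathematicalPhysics.KineticTheory.HardSphereCanonicalTorus

/-!
# `GibbsLightCone` without `0 < σ` is FALSE: the ideal gas has no light cone

Negative knowledge for the crux `RelayRaceLocality.GibbsLightCone` (stmt-AtomisticToContinuum-12501),
from the standing disprover's `Cruxes/GibbsLightCone/Disproof.lean` §A (the one PHYSICALLY
load-bearing hypothesis of the crux, cf. the route file's CHEAPEST FALSIFIER (iii): "the statement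
has teeth exactly through `ℓ → 0`").

`GibbsLightConeWithoutPosDiameter` is the crux verbatim with the hypothesis `0 < σ` deleted, so the
reduced diameter `σ = -1` must be covered. Then every sphere diameter `hsDiameter (-1) N` is
NEGATIVE: the hard-sphere domain is all of phase space, the contact sets are empty, there are no
collisions, and FREE FLIGHT packaged with the good set `univ` is a `HardSphereFlow`
(`idealGasFlow`; Liouville = Lebesgue is preserved by `measurePreserving_freeFlight_torus_holds`).
Under the homogeneous Gibbs law the velocity of particle `0` is Maxwellian whatever the hard core
(`localGibbsLaw_vel_apply`, from the disintegration `lintegral_localGibbsMeasure`), so with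
`a = θ = 1`, `t = 1/(8c)`, `δ = 1/8` the `j = i = 0` clause of the crux event contains
`{1/4 < ‖t v₀‖ < 1/2}` (on which `dist(x₀, x₀ + t v₀) = ‖t v₀‖ > c t + δ = 1/4`, no wrap-around),
an event of FIXED positive Gaussian probability: the crux probabilities do not tend to `0`.
Unconditional (`gibbsLightCone_false_without_posDiameter`). Moral for provers: any proof of the
crux uses collisions quantitatively (the own-displacement clause alone needs `ℓ_N → 0`).

Reusable by other disprover seats of this sub-problem (same `∀ σ, 0 < σ → σ < σ₀ →` pattern):
`idealGasFlow` (free flight as a `HardSphereFlow` at negative diameter) and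
`localGibbsLaw_vel_apply` (one-particle velocity marginal of the homogeneous Gibbs law, any
`σ ≤ 1/2`). refuter-cdisprove-stmt-AtomisticToContinuum-12501-0.
-/

noncomputable section

namespace Summit.AtomisticToContinuum.HydrodynamicLimit.Theorems

open MeasureTheory Filter Set
open scoped ENNReal Topology
open Literature.MathematicalPhysics.KineticTheory Literature.Analysis.FluidPDE
open Literature.Analysis.FunctionSpaces (Torus.proj Torus.proj_add Torus.continuous_proj
  Torus.measurable_proj)
open Summit.AtomisticToContinuum.HydrodynamicLimit.Theses.RelayRaceLocality (GibbsLightCone)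

/-- The crux `GibbsLightCone` with the hypothesis `0 < σ` DELETED (all else verbatim). -/
def GibbsLightConeWithoutPosDiameter : Prop :=
  ∀ a θ : ℝ, 0 < a → 0 < θ → ∃ σ₀ : ℝ, 0 < σ₀ ∧ ∃ c : ℝ, 0 < c ∧ ∀ σ : ℝ, σ < σ₀ →
    ∀ Φ : (N : ℕ) → HardSphereFlow (Torus.geometry (Fin 3)) (hsDiameter σ N) (N + 1),
    ∀ t : ℝ, 0 ≤ t → ∀ δ : ℝ, 0 < δ →
      Tendsto (fun N => localGibbsLaw σ (fun _ => a) (fun _ => 0) (fun _ => θ) N (Φ N)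
        {z | ∃ i j : Fin (N + 1), (j = i ∨ j ∈ (Φ N).backwardCluster i 0 t z) ∧
          c * t + δ < Torus.euclidDist (z j).1 ((Φ N).flow t z i).1}) atTop (𝓝 0)

namespace GibbsLightConeWithoutPosDiameter

/-- Sanity (contrapositive form, so that no Theses decl is concluded positively): the variant is
the crux minus exactly `0 < σ`. [folklore] -/
theorem not_of_not_crux : ¬ GibbsLightCone → ¬ GibbsLightConeWithoutPosDiameter := by
  intro hn h
  refine hn fun a θ ha hθ => ?_
  obtain ⟨σ₀, hσ₀, c, hc, h⟩ := h a θ ha hθ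
  exact ⟨σ₀, hσ₀, c, hc, fun σ _ hσ' Φ t ht δ hδ => h σ hσ' Φ t ht δ hδ⟩

/-! ### The ideal gas: free flight is a hard-sphere flow at negative diameter -/

/-- For a nonpositive diameter the hard-sphere domain is all of phase space. [folklore] -/
theorem hardSphereDomain_eq_univ {ε : ℝ} (hε : ε ≤ 0) (N : ℕ) :
    hardSphereDomain (Torus.geometry (Fin 3)) N ε = univ :=
  eq_univ_of_forall fun _ _ _ _ => hε.trans (norm_nonneg _)

/-- For a negative diameter the contact sets are empty (a norm is never negative). [folklore] -/
theorem contactSet_eq_empty {ε : ℝ} (hε : ε < 0) (N : ℕ) (i j : Fin N) :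
    contactSet (Torus.geometry (Fin 3)) N ε i j = ∅ :=
  eq_empty_of_forall_notMem fun _ hz => (hε.trans_le (norm_nonneg _)).ne' (mem_contactSet.1 hz).2

/-- For a negative diameter no curve has a collision time. [folklore] -/
theorem collisionTimes_eq_empty {ε : ℝ} (hε : ε < 0) {N : ℕ} (γ : ℝ → Config N (Fin 3) T3) :
    collisionTimes (Torus.geometry (Fin 3)) ε γ = ∅ := by
  ext t
  simp [mem_collisionTimes, contactSet_eq_empty hε]

/-- Free flight on the torus phase space is measurable. [folklore] -/
theorem measurable_freeFlight_torus (N : ℕ) (t : ℝ) :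
    Measurable (freeFlight (N := N) (Torus.geometry (Fin 3)) t) := by
  refine measurable_pi_lambda _ fun i => ?_
  refine Measurable.prodMk ?_ (measurable_pi_apply i).snd
  show Measurable fun z : Config N (Fin 3) T3 => (z i).1 + Torus.proj (t • (z i).2)
  exact (measurable_pi_apply i).fst.add
    (Torus.measurable_proj.comp ((measurable_pi_apply i).snd.const_smul t))

/-- For a negative diameter every free-flight orbit is a hard-sphere trajectory (no collision
times; the `free` field is the group law of free flight). [folklore] -/
theorem isHardSphereTrajectory_freeFlight {ε : ℝ} (hε : ε < 0) {N : ℕ} (z : Config N (Fin 3) T3) :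
    IsHardSphereTrajectory (Torus.geometry (Fin 3)) ε N
      fun t => freeFlight (Torus.geometry (Fin 3)) t z where
  mem t := by
    rw [hardSphereDomain_eq_univ hε.le]
    exact mem_univ _
  locFinite a b := by
    rw [collisionTimes_eq_empty hε, empty_inter]
    exact finite_empty
  pos_continuous i := by
    show Continuous fun t : ℝ => (z i).1 + Torus.proj (t • (z i).2)
    exact continuous_const.add (Torus.continuous_proj.comp (continuous_id.smul continuous_const))
  free s t _ _ := by
    show freeFlight (Torus.geometry (Fin 3)) t z =
      freeFlight (Torus.geometry (Fin 3)) (t - s) (freeFlight (Torus.geometry (Fin 3)) s z)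
    rw [← freeFlight_add, sub_add_cancel]
  binary t i j _ hc := by
    rw [contactSet_eq_empty hε] at hc
    exact absurd hc (notMem_empty _)

/-- **The ideal-gas flow**: for a negative diameter, free flight with good set `univ` is a
`HardSphereFlow` (Liouville = Lebesgue, preserved by free flight:
`measurePreserving_freeFlight_torus_holds`). [folklore] -/
def idealGasFlow {ε : ℝ} (hε : ε < 0) (N : ℕ) : HardSphereFlow (Torus.geometry (Fin 3)) ε N where
  flow t z := freeFlight (Torus.geometry (Fin 3)) t z
  good := univ
  measurableSet_good := MeasurableSet.univ
  good_subset := fun z _ => by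
    rw [hardSphereDomain_eq_univ hε.le]
    exact mem_univ z
  measure_compl_good := by rw [compl_univ, measure_empty]
  mapsTo_good _ := mapsTo_univ _ _
  flow_zero z _ := freeFlight_zero _ z
  flow_add s t z _ := freeFlight_add _ s t z
  measurable_flow t := measurable_freeFlight_torus N t
  isTrajectory z _ := isHardSphereTrajectory_freeFlight hε z
  measurePreserving t := by
    rw [liouville_eq, hardSphereDomain_eq_univ hε.le, Measure.restrict_univ]
    exact Literature.Barriers.AtomisticToContinuum.measurePreserving_freeFlight_torus_holds
      (d := Fin 3) (N := N) t

/-- The diameters of the variant at `σ = -1` are negative. [folklore] -/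
theorem hsDiameter_neg_one_neg (N : ℕ) : hsDiameter (-1) N < 0 :=
  mul_neg_of_neg_of_pos (by norm_num) (Real.rpow_pos_of_pos (by positivity) _)

/-! ### One free particle does not wrap around before half the torus -/

/-- A torus point displaced by `q` with `‖q‖ < 1/2` is at minimal-image distance exactly `‖q‖`.
[folklore] -/
theorem euclidDist_self_add_proj (x : T3) {q : V3} (hq : ‖q‖ < 1 / 2) :
    Torus.euclidDist x (x + Torus.proj q) = ‖q‖ := by
  have hx : Torus.proj (Torus.reprSym x) = x := Torus.proj_reprSym x
  have hpq : ‖Torus.reprSym x - (Torus.reprSym x + q)‖ < 1 / 2 := by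
    rwa [sub_add_cancel_left, norm_neg]
  conv_lhs => rw [← hx, ← Torus.proj_add]
  rw [euclidDist_proj_proj_of_norm_lt hpq, sub_add_cancel_left, norm_neg]

/-! ### The velocity of one particle is Maxwellian under the homogeneous Gibbs law -/

/-- **One-particle velocity marginal of the homogeneous Gibbs law**: for `a, θ > 0`, `σ ≤ 1/2`
(any sign of `σ`), every `N`, flow and particle `i`, and every measurable `S ⊆ ℝ³`,
`G_N {z | v_i ∈ S} = N(0, θ id)(S)` — velocities are i.i.d. Maxwellian whatever the hard core
(disintegration `lintegral_localGibbsMeasure` applied to `𝟙_{v_i ∈ S}` and to `1`). [folklore] -/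
theorem localGibbsLaw_vel_apply {σ a θ : ℝ} (ha : 0 < a) (hθ : 0 < θ) (hσ : σ ≤ 1 / 2) (N : ℕ)
    (Φ : HardSphereFlow (Torus.geometry (Fin 3)) (hsDiameter σ N) (N + 1)) (i : Fin (N + 1))
    {S : Set V3} (hS : MeasurableSet S) :
    localGibbsLaw σ (fun _ => a) (fun _ => 0) (fun _ => θ) N Φ {z | (z i).2 ∈ S} =
      gaussMeasure (0 : V3) θ S := by
  haveI hP : IsProbabilityMeasure
      (localGibbsMeasure σ (fun _ => a) (fun _ => (0 : V3)) (fun _ => θ) N) := by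
    have h := isProbabilityMeasure_localGibbsLaw (a₀ := fun _ => a) (θ₀ := fun _ => θ)
      (u₀ := fun _ => (0 : V3)) continuous_const continuous_const continuous_const
      (fun _ => ha) (fun _ => hθ) hσ N Φ
    rwa [localGibbsLaw_eq] at h
  rw [localGibbsLaw_eq]
  -- the position weight of the disintegration
  set w : (Fin (N + 1) → T3) → ℝ≥0∞ := fun x => ENNReal.ofReal
    ((canonicalPartition (Torus.geometry (Fin 3)) (hsDiameter σ N) (N + 1)
      (localGibbsProfile (fun _ => a) (fun _ => (0 : V3)) (fun _ => θ)))⁻¹ *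
      posWeight (fun _ => a) (hsDiameter σ N) (N + 1) x) with hw
  have hwm : Measurable w :=
    (measurable_const.mul (measurable_posWeight (a₀ := fun _ => a) continuous_const _ _)).ennreal_ofReal
  have hdis : ∀ {G : Config (N + 1) (Fin 3) T3 → ℝ≥0∞}, Measurable G →
      ∫⁻ z, G z ∂localGibbsMeasure σ (fun _ => a) (fun _ => (0 : V3)) (fun _ => θ) N =
        ∫⁻ x, w x * ∫⁻ v, G (zipConfig (x, v)) ∂velMeasure (fun _ => (0 : V3)) (fun _ => θ) x :=
    fun hG => lintegral_localGibbsMeasure (a₀ := fun _ => a) (θ₀ := fun _ => θ)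
      (u₀ := fun _ => (0 : V3)) continuous_const continuous_const continuous_const
      (fun _ => ha.le) (fun _ => hθ) σ N hG
  have hE : MeasurableSet {z : Config (N + 1) (Fin 3) T3 | (z i).2 ∈ S} :=
    (measurable_pi_apply i).snd hS
  have hvel : ∀ x : Fin (N + 1) → T3,
      velMeasure (fun _ => (0 : V3)) (fun _ => θ) x {v | v i ∈ S} = gaussMeasure (0 : V3) θ S :=
    fun x => (measurePreserving_eval (fun _ : Fin (N + 1) => gaussMeasure (0 : V3) θ) i).measure_preimage
      hS.nullMeasurableSet
  -- the event: its probability is (total position mass) × N(0,θ)(S)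
  have h1 : localGibbsMeasure σ (fun _ => a) (fun _ => (0 : V3)) (fun _ => θ) N
      {z | (z i).2 ∈ S} = (∫⁻ x, w x) * gaussMeasure (0 : V3) θ S := by
    rw [← lintegral_indicator_one hE, hdis (measurable_one.indicator hE)]
    have hin : ∀ x : Fin (N + 1) → T3,
        ∫⁻ v, ({z : Config (N + 1) (Fin 3) T3 | (z i).2 ∈ S}).indicator
            (1 : Config (N + 1) (Fin 3) T3 → ℝ≥0∞) (zipConfig (x, v))
          ∂velMeasure (fun _ => (0 : V3)) (fun _ => θ) x = gaussMeasure (0 : V3) θ S := by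
      intro x
      have hfun : (fun v : Fin (N + 1) → V3 =>
          ({z : Config (N + 1) (Fin 3) T3 | (z i).2 ∈ S}).indicator
            (1 : Config (N + 1) (Fin 3) T3 → ℝ≥0∞) (zipConfig (x, v))) =
          ({v : Fin (N + 1) → V3 | v i ∈ S}).indicator 1 := by
        funext v
        by_cases hv : v i ∈ S
        · have hz : zipConfig (x, v) ∈ {z : Config (N + 1) (Fin 3) T3 | (z i).2 ∈ S} := by
            show (zipConfig (x, v) i).2 ∈ S
            rw [zipConfig_apply]
            exact hv
          rw [Set.indicator_of_mem hz,
            Set.indicator_of_mem (show v ∈ {v : Fin (N + 1) → V3 | v i ∈ S} from hv)]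
          rfl
        · have hz : zipConfig (x, v) ∉ {z : Config (N + 1) (Fin 3) T3 | (z i).2 ∈ S} := by
            show (zipConfig (x, v) i).2 ∉ S
            rw [zipConfig_apply]
            exact hv
          rw [Set.indicator_of_notMem hz,
            Set.indicator_of_notMem (show v ∉ {v : Fin (N + 1) → V3 | v i ∈ S} from hv)]
      have hSv : MeasurableSet {v : Fin (N + 1) → V3 | v i ∈ S} := (measurable_pi_apply i) hS
      rw [hfun, lintegral_indicator_one hSv, hvel]
    simp_rw [hin]
    exact lintegral_mul_const _ hwm
  -- total mass: (total position mass) × 1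
  have h2 : localGibbsMeasure σ (fun _ => a) (fun _ => (0 : V3)) (fun _ => θ) N univ =
      ∫⁻ x, w x := by
    rw [← lintegral_one, hdis measurable_const]
    refine lintegral_congr fun x => ?_
    rw [lintegral_one, measure_univ, mul_one]
  rw [h1, ← h2, measure_univ, one_mul]

/-- A centred Gaussian on `ℝ³` charges every nonempty open set (positive continuous density).
[folklore] -/
theorem gaussMeasure_pos_of_isOpen {θ : ℝ} (hθ : 0 < θ) {S : Set V3} (hS : IsOpen S)
    (hne : S.Nonempty) : 0 < gaussMeasure (0 : V3) θ S := by
  rw [← withDensity_localMaxwellian_eq_gaussMeasure hθ (0 : V3), pos_iff_ne_zero, Ne,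
    withDensity_apply_eq_zero'
      (continuous_localMaxwellian 1 θ (0 : V3)).measurable.ennreal_ofReal.aemeasurable]
  have hset : {v : V3 | ENNReal.ofReal (localMaxwellian 1 θ (0 : V3) v) ≠ 0} = univ :=
    eq_univ_of_forall fun v => (ENNReal.ofReal_pos.2 (localMaxwellian_pos one_pos hθ _ _)).ne'
  rw [hset, univ_inter]
  exact (hS.measure_pos volume hne).ne'

end GibbsLightConeWithoutPosDiameter

open GibbsLightConeWithoutPosDiameter in
/-- **`GibbsLightCone` without `0 < σ` is false: the ideal gas has no light cone.** Witness:
`a = θ = 1`; `σ = -1` (negative diameters, free flight `idealGasFlow`); `t = 1/(8c)`, `δ = 1/8`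
(threshold `c t + δ = 1/4`); the sub-event `{1/4 < ‖t v₀‖ < 1/2}` of the `j = i = 0` clause has
Gibbs probability `N(0, id){1/4 < ‖t v‖ < 1/2} > 0` for EVERY `N` (`localGibbsLaw_vel_apply`,
`euclidDist_self_add_proj`), so the crux probabilities do not tend to `0`. Any proof of the crux
must therefore use `0 < σ`, i.e. collisions (`ℓ_N → 0`), already for the own-displacement clause.
[folklore] -/
theorem gibbsLightCone_false_without_posDiameter : ¬ GibbsLightConeWithoutPosDiameter := by
  intro h
  obtain ⟨σ₀, hσ₀, c, hc, h⟩ := h 1 1 one_pos one_pos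
  -- the ideal-gas flows at `σ = -1`
  set Φ : (N : ℕ) → HardSphereFlow (Torus.geometry (Fin 3)) (hsDiameter (-1) N) (N + 1) :=
    fun N => idealGasFlow (hsDiameter_neg_one_neg N) (N + 1) with hΦ
  -- times and overshoot: threshold `c t + δ = 1/4`
  set t : ℝ := 1 / (8 * c) with ht
  have htpos : 0 < t := by positivity
  have hthr : c * t + 1 / 8 = 1 / 4 := by
    rw [ht]
    field_simp
    norm_num
  have key := h (-1) (by linarith) Φ t htpos.le (1 / 8) (by norm_num)
  -- the velocity sub-event
  set S : Set V3 := {w | 1 / 4 < ‖t • w‖ ∧ ‖t • w‖ < 1 / 2} with hSdef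
  have hSopen : IsOpen S :=
    isOpen_Ioo.preimage (continuous_id.const_smul t).norm
  have hSne : S.Nonempty := by
    obtain ⟨u, hu⟩ := exists_ne (0 : V3)
    have hun : 0 < ‖u‖ := norm_pos_iff.2 hu
    refine ⟨(3 / (8 * t * ‖u‖)) • u, ?_⟩
    have hnorm : ‖t • ((3 / (8 * t * ‖u‖)) • u)‖ = 3 / 8 := by
      rw [norm_smul, norm_smul, Real.norm_eq_abs, Real.norm_eq_abs, abs_of_pos htpos,
        abs_of_pos (by positivity)]
      field_simp
    refine ⟨?_, ?_⟩ <;> rw [hnorm] <;> norm_num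
  have hSmeas : MeasurableSet S := hSopen.measurableSet
  -- the sub-event lies in the crux event, for every N
  have hsub : ∀ N : ℕ, {z : Config (N + 1) (Fin 3) T3 | (z 0).2 ∈ S} ⊆
      {z | ∃ i j : Fin (N + 1), (j = i ∨ j ∈ (Φ N).backwardCluster i 0 t z) ∧
        c * t + 1 / 8 < Torus.euclidDist (z j).1 ((Φ N).flow t z i).1} := by
    intro N z hz
    refine ⟨0, 0, Or.inl rfl, ?_⟩
    show c * t + 1 / 8 < Torus.euclidDist (z 0).1 ((z 0).1 + Torus.proj (t • (z 0).2))
    rw [euclidDist_self_add_proj _ hz.2, hthr]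
    exact hz.1
  -- hence a fixed positive lower bound
  have hpos : 0 < gaussMeasure (0 : V3) 1 S := gaussMeasure_pos_of_isOpen one_pos hSopen hSne
  have hge : ∀ N : ℕ, gaussMeasure (0 : V3) 1 S ≤
      localGibbsLaw (-1) (fun _ => 1) (fun _ => 0) (fun _ => 1) N (Φ N)
        {z | ∃ i j : Fin (N + 1), (j = i ∨ j ∈ (Φ N).backwardCluster i 0 t z) ∧
          c * t + 1 / 8 < Torus.euclidDist (z j).1 ((Φ N).flow t z i).1} := fun N =>
    (localGibbsLaw_vel_apply one_pos one_pos (by norm_num) N (Φ N) 0 hSmeas).symm.le.trans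
      (measure_mono (hsub N))
  obtain ⟨N, hN⟩ := (key.eventually (gt_mem_nhds hpos)).exists
  exact absurd (hge N) (not_le.2 hN)

end Summit.AtomisticToContinuum.HydrodynamicLimit.Theorems

end
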